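import Summits.QuantumFields.YangMills.Theorems.UnitScaleTiltProp7ChartPrint
import HarnessLib

/-!
# Route `UnitScaleTilt`, crux K1 child «MinimiserStabilityRegPr» (stmt-QuantumFields-19200), registered stub `stub_prop7From14` (skeleton birth_v7
# cc37a178…; leaf V3) — THE TWO-PILLAR GLUE FOR THE OWNER'S v8 RE-CUT OF V3 AT PRINT'S PRESENTATION: `Prop7From14At L B₃` ⇐
# P-V3-A (`∃ B₁ c₁, Prop2Printed …`) ∧ P-V3-CDE (`∃ B₀ B₁ O₁ O₂ e₅, Prop5Printed ∧ Prop6Printed ∧ ExistenceLeavesCap`), the constants of the two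
# pillars RECONCILED by the monotonicity of [Balaban1985Variational] Props 2 and 5 in Thm 2's constant `B₁`

Cell `ym3-torus` ∕ fleet seat `ym-ust-19200-p1` (gen 8; HUMAN RULING D-0037, YM ladder rung R3).  WHY.  `Prop7ChartPrint.prop7From14At_of_props_print`
(p570581) gives V3 from `Prop2Printed B₁ … ∧ Prop5Printed B₁ … ∧ Prop6Printed B₀ …` + leaves with ONE shared `B₁` and `B₀ ≤ 4B₁` (print p. 296 «we have
B₁ = 5dLB₀»).  A two-stub re-cut (OWNER ym3-torus-plan g23, 2026-08-27 20:03Z: P-V3-A := Prop. 2 = [Balaban1985RegularSpaces] Thm 2; P-V3-CDE := Props 5,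
6 [+ the located existence leaves]) quantifies its constants SEPARATELY; this file shows that is harmless: `Prop2Printed` and `Prop5Printed` are
MONOTONE in `B₁` (a larger `B₁` only strengthens the hypothesis `B₁(ε₀ + C₁ε₁) ≤ ε₂`), so both pillars lift to `B₁* := max{B₁ᴬ, B₁ᶜ, B₀/4}` and the
knit applies.  For every presentation `S` over `Idx L` whose `IsAxial` IS the based (1.19)-reading and whose `Restricted` implies the based
(1.29)-reading (print's letters, `Prop7AxialReprPrint`), hence — once the typer lane's `S_print` is a declaration — the v8 composition
`stub_prop7From14 ⇐ stub_PV3A ∧ stub_PV3CDE` is `prop7From14At_of_pillars_print` BY NAME.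

WHAT IS PROVED (sorry-free, no definition): `prop2Printed_mono`, `prop5Printed_mono` (monotonicity in `B₁`, `C₁ ≥ 0`, `B₃ ≥ 0`),
**`prop7From14At_of_pillars_print`**.

HONEST SCOPE.  Bookkeeping of constants; the pillars are hypotheses (typed statements of record at the presented family); count-neutral helper toward
stmt-QuantumFields-19200 (`--supports`), not a proof of the stub.

References: T. Bałaban, CMP 102 (1985) 277–309 [Balaban1985Variational] (Prop. 2 p.281, Prop. 5 (111)–(112) p.294, Prop. 6 p.295, (122) and «we have
B₁ = 5dLB₀» p.296, Prop. 7 p.299).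
-/

noncomputable section

namespace Summit.QuantumFields.YangMills.Theorems.Prop7PillarsPrint

open Literature.MathematicalPhysics.QuantumFieldTheory.Balaban1983to89
open Literature.MathematicalPhysics.QuantumFieldTheory.Balaban1983to89.T3ContinuumYM3Torus
open B11 (LGData Prop2Printed Prop5Printed Prop6Printed)
open B11Prop7Assembly (ExistenceLeavesCap)
open B7Prop1Explicit renaming Site → LSite
open B8Eq119TwistedAxial (InAx Restr129)
open B8Thm4TorusAt (torusLam)
open B15DeterminingSets (embIter)
open B10Eq27TorusAxialLog (pull unitsField toUField)
open B8Thm2SetupTorus (pullGauge toUGauge)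
open T3Thm1Carrier
open T3Thm1CarrierNative (Prop7From14At)
open T3SectALandauChart
open Summit.QuantumFields.YangMills.Theorems.Prop7ChartPrint (prop7From14At_of_props_print)

/-! ## §1 Monotonicity of Props 2 and 5 in Thm 2's constant `B₁` -/

section Mono

variable {I : Type}

/-- **`Prop2Printed` IS MONOTONE IN `B₁`**: a larger `B₁` only strengthens the hypothesis `B₁(ε₀ + C₁ε₁) ≤ ε₂` of Prop. 2 (`ε₀, ε₁ > 0`, `C₁ ≥ 0`).
[cite: Balaban1985Variational, Prop. 2 p.281] -/
theorem prop2Printed_mono {B₁ B₁' B₃ C₁ c₁ : ℝ} {fam : I → LGData} (hB : B₁ ≤ B₁') (hC₁ : 0 ≤ C₁)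
    (h : Prop2Printed B₁ B₃ C₁ c₁ fam) : Prop2Printed B₁' B₃ C₁ c₁ fam := by
  intro i ε₀ ε₁ ε₂ hε₀ hε₁ hsum hε₂ V U₀ h14 U' h18 hcrit
  have hnn : 0 ≤ ε₀ + C₁ * ε₁ := by positivity
  exact h i ε₀ ε₁ ε₂ hε₀ hε₁ hsum ((mul_le_mul_of_nonneg_right hB hnn).trans hε₂) V U₀ h14 U' h18 hcrit

/-- **`Prop5Printed` IS MONOTONE IN `B₁`** (same reason; `ε₁ > 0`, `B₃ε₁ ≤ ε₀` with `B₃ ≥ 0`, `C₁ ≥ 0`). [cite: Balaban1985Variational, Prop. 5 p.294] -/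
theorem prop5Printed_mono {B₁ B₁' B₃ C₁ : ℝ} {fam : I → LGData} (hB : B₁ ≤ B₁') (hC₁ : 0 ≤ C₁) (hB₃ : 0 ≤ B₃)
    (h : Prop5Printed B₁ B₃ C₁ fam) : Prop5Printed B₁' B₃ C₁ fam := by
  obtain ⟨c, hc, H⟩ := h
  refine ⟨c, hc, fun i ε₀ ε₁ ε₂ ε₃ hε₁ hB₃ε hε₂ hε₂₃ hε₃ V U₀ h14 U₁ h19 hcrit => ?_⟩
  have hε₀ : 0 ≤ ε₀ := le_trans (by positivity) hB₃ε
  have hnn : 0 ≤ ε₀ + C₁ * ε₁ := by positivity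
  exact H i ε₀ ε₁ ε₂ ε₃ hε₁ hB₃ε ((mul_le_mul_of_nonneg_right hB hnn).trans hε₂) hε₂₃ hε₃ V U₀ h14 U₁ h19 hcrit

end Mono

/-! ## §2 The two-pillar glue at print's based presentation -/

section Glue

open scoped Matrix.Norms.L2Operator

variable {L : ℕ}

/-- **V3 FROM THE TWO PILLARS AT PRINT'S PRESENTATION** (the owner's re-cut, glued): for `L > 1`, `B₃ ≥ 1` and a presentation `S` over `Idx L` with
print's based Sect. A letters (`IsAxial ↔` (1.19), `Restricted →` (1.29), pullbacks based at `embIter (K−n) 0`),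
P-V3-A `∃ B₁ c₁ > 0, Prop2Printed B₁ B₃ L³ c₁ (famLG3 L S)` and P-V3-CDE `∃ B₀ B₁ O₁ O₂ e₅, Prop5Printed B₁ B₃ L³ ∧ Prop6Printed B₀ B₃ L³ ∧ ∀ i,
ExistenceLeavesCap (bridgeFam3 L S i) B₀ B₃ L³ O₁ O₂ e₅` imply `T3Thm1CarrierNative.Prop7From14At L B₃` — the constants reconciled at
`B₁* = max{B₁ᴬ, B₁ᶜ, B₀/4}` (`prop2Printed_mono`, `prop5Printed_mono`; `B₀ ≤ 4B₁*`), then `Prop7ChartPrint.prop7From14At_of_props_print`.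
[cite: Balaban1985Variational, Prop. 7 p.299, Prop. 2 p.281, Props 5-6 pp.294-295, p.296 («we have B₁ = 5dLB₀»)] -/
theorem prop7From14At_of_pillars_print (hL : 1 < L) (S : ResidFam L) {B₃ : ℝ} (hB₃ : 1 ≤ B₃)
    (hSax : ∀ (i : Idx L) (U₀ U : GaugeField (i.1.1.P i.1.2.2) 0 (Matrix.specialUnitaryGroup (Fin 2) ℂ)),
      (S i).IsAxial U₀ U ↔
        InAx (i.1.1.P i.1.2.2).L (i.1.2.2 - i.1.2.1) (torusLam (i.1.2.2 - i.1.2.1))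
          (pull (unitsField (toUField U₀)) (embIter (i.1.2.2 - i.1.2.1) (0 : Site (i.1.1.P i.1.2.2) (i.1.2.2 - i.1.2.1))))
          (pull (unitsField (toUField U)) (embIter (i.1.2.2 - i.1.2.1) (0 : Site (i.1.1.P i.1.2.2) (i.1.2.2 - i.1.2.1)))))
    (hSre : ∀ (i : Idx L) (U₀ : GaugeField (i.1.1.P i.1.2.2) 0 (Matrix.specialUnitaryGroup (Fin 2) ℂ))
      (u : GaugeTransf (i.1.1.P i.1.2.2) 0 (Matrix.specialUnitaryGroup (Fin 2) ℂ)), (S i).Restricted U₀ u →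
        Restr129 (i.1.1.P i.1.2.2).L (i.1.2.2 - i.1.2.1) (torusLam (i.1.2.2 - i.1.2.1))
          (pull (unitsField (toUField U₀)) (embIter (i.1.2.2 - i.1.2.1) (0 : Site (i.1.1.P i.1.2.2) (i.1.2.2 - i.1.2.1))))
          (pullGauge (fun x => Unitary.toUnits (toUGauge (i.1.1.P i.1.2.2) 2 u x)) (embIter (i.1.2.2 - i.1.2.1) (0 : Site (i.1.1.P i.1.2.2) (i.1.2.2 - i.1.2.1)))))
    (hA : ∃ B₁ c₁ : ℝ, 0 < B₁ ∧ 0 < c₁ ∧ Prop2Printed B₁ B₃ ((L : ℝ) ^ 3) c₁ (famLG3 L S))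
    (hCDE : ∃ B₀ B₁ O₁ O₂ e₅ : ℝ, 0 < B₀ ∧ 0 < B₁ ∧ 1 ≤ O₁ ∧ 1 ≤ O₂ ∧ 0 < e₅ ∧
      Prop5Printed B₁ B₃ ((L : ℝ) ^ 3) (famLG3 L S) ∧ Prop6Printed B₀ B₃ ((L : ℝ) ^ 3) (famLG3 L S) ∧
      ∀ i : Idx L, ExistenceLeavesCap (bridgeFam3 L S i) B₀ B₃ ((L : ℝ) ^ 3) O₁ O₂ e₅) :
    Prop7From14At L B₃ := by
  obtain ⟨B₁, c₁, hB₁, hc₁, h2⟩ := hA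
  obtain ⟨B₀, B₁', O₁, O₂, e₅, hB₀, hB₁', hO₁, hO₂, he₅, h5, h6, leaves⟩ := hCDE
  have hC₁ : (0 : ℝ) ≤ (L : ℝ) ^ 3 := by positivity
  -- reconcile Thm 2's constant: `B₁* = max{B₁, B₁', B₀/4}`
  set Bs : ℝ := max B₁ (max B₁' (B₀ / 4)) with hBs
  have h1 : B₁ ≤ Bs := le_max_left _ _
  have h1' : B₁' ≤ Bs := (le_max_left _ _).trans (le_max_right _ _)
  have h0 : B₀ / 4 ≤ Bs := (le_max_right _ _).trans (le_max_right _ _)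
  have hBs0 : 0 < Bs := lt_of_lt_of_le hB₁ h1
  have hB₀Bs : B₀ ≤ 4 * Bs := by linarith
  exact prop7From14At_of_props_print hL S hSax hSre leaves hB₀ hBs0 hB₃ hB₀Bs hc₁ hO₁ hO₂ he₅
    (prop2Printed_mono h1 hC₁ h2) (prop5Printed_mono h1' hC₁ (by linarith) h5) h6

end Glue

end Summit.QuantumFields.YangMills.Theorems.Prop7PillarsPrint

end
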